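import Literature.MathematicalPhysics.QuantumFieldTheory.Balaban1983to89.B15Prop1WindowDirectPackageFromLetters
import Literature.MathematicalPhysics.QuantumFieldTheory.Balaban1983to89.Node00.TorusCoverGaugeTokensR

/-!
# `Balaban1983to89.B15Prop1PlaquetteLettersOfClass` — [Balaban1985Variational] (2) p. 278 ∕ [Balaban1988Convergent] (2.12)–(2.13) pp. 256–257: THE TWO PLAQUETTE
# LETTERS OF THE N12 DIRECT ROAD (`hPχ` on the `Ω₁(Z)`-touching plaquettes, `hPbox` on the tower boxes around inner `j`-sites) ARE READ OFF THE MINIMISER'S OWN (2.12) CLASS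

Honest framing: statement-level skeleton of published definitions with citation tags; proofs are lattice bookkeeping; nothing here is a claim about the Yang–Mills mass gap.

Cell `pub-ymgap`, HUMAN RULINGS D-0062 ∕ D-0149, node N12 = [B15], lane-owner seat `pub-ymgap-dag-n12-c` (g21; pen ρ4 of the lane's «DIRECT ROW» census); count-neutral helper of K1⁹
`stmt-QuantumFields-27364`.

WHAT.  The direct road's Prop-1 endpoints ((P2c)′ `N12Prop1DirectOfChartHalfExplicit`, dag-n12-d's (D1)′ ∕ (E1)′, the knit «12Q-DIRECT») display, inside their tolerance frame, two
letters about every (2.12) minimiser `U₀ ∈ U_k({Ω_j(Z)}, εreg)` of a guarded datum: `hPχ` — `‖U₀(∂p) − 1‖ ≤ δ` for every plaquette `p` with a corner-bond starting in `Ω₁(Z)` — and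
`hPbox` — `PlaqSmallOn` at `δ` on the fine box of half-width `Lʲ + (Lʲ−1)∕2` around `ι_j y` for every inner `j`-site `y` (`ι_j y ∈ Ω_j(Z)`, `1 ≤ j ≤ k`; the premise of dag-n12-w6's right
inverse `exists_rightInverse_letter`).  Both are CONSEQUENCES OF THE CLASS ITSELF — [15] (2): *«|U(∂p) − 1| < ε₀η_j² for p ∈ Ω_j»* (`Node00.regMSCoPOfRecord`, first conjunct, scale-`0`
domain = the support of record `Ω₁ +` one layer of `M₁`-cubes) — and of the geometry of the maximal sequence (2.13) (*«dist(Ω_n, Ωᶜ_{n−1}) ≥ LⁿξM₁»*, r11's `dist_maxDomT`; the support's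
layer, `Node00.cover_mem_hullD_one_of_within`), at ANY tolerance `δ ≥ εreg` (`η_j ≤ 1`).  So the endpoints' frame keeps ONE numeric floor `εreg ≤ δ i` in their place.

CONTENTS (namespace `Literature.MathematicalPhysics.QuantumFieldTheory.Balaban1983to89.B15Prop1PlaquetteLettersOfClass`; theorems only — no `def`, no `instance`, no `sorry`).
* §1 `eta_sq_le_one`, `dist1_plaqHol_lt_of_mem_class` (the class's first conjunct at level `j ≤ k`, tolerance weakened to `εreg`).
* §2 ★★ `norm_plaqHol_sub_one_le_of_isMinimizer_of_cornerBond` — the letter `hPχ` at any `δ ≥ εreg` (level `1`).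
* §3 ★★ `within_of_mem_boxPlaqs`, ★★★ `plaqSmallOn_towerBox_of_isMinimizer` — the letter `hPbox` at any `δ ≥ εreg` (level `j − 1` through `dist_maxDomT` for `j ≥ 2`; the support's
  `M₁`-layer for `j = 1`, radius `L + (L−1)∕2 ≤ M₁`).
* §4 ★★★ `hPχ_on_of_class`, ★★★ `hPbox_on_of_class` — the FAMILY forms: the endpoints' displayed binders `hPχ` ∕ `hPbox` VERBATIM (per instance, per guarded base field, per minimiser),
  from `0 ≤ εreg`, `εreg ≤ δ i` (+ `2 ≤ M₁`, `L + (L−1)∕2 ≤ M₁`, `LᵏM₁ ∣ 2L^{m+K}` for `hPbox`).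

HONEST SCOPE.  Reads the minimiser's class membership (`IsMinimizer….1`) and lattice geometry; the minimiser's EXISTENCE, [15] Thm 1 and everything analytic stay where they are;
count-neutral; N12 NOT discharged; K1⁹ NOT closed; one finite four-torus programme at fixed `ε = L^{-K}` — nothing continuum ∕ ℝ⁴ ∕ OS ∕ mass gap ∕ Clay.

## References
* [Balaban1985Variational] T. Bałaban, *The variational problem and background fields in renormalization group method for lattice gauge theories*, Commun. Math. Phys. 102
  (1985) 277–309, (2) p. 278, Thm 1 (8) p. 279.
* [Balaban1988Convergent] T. Bałaban, *Convergent renormalization expansions for lattice gauge theories*, Commun. Math. Phys. 119 (1988) 243–285, p. 255, (2.12)–(2.13) pp. 256–257.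
* [Balaban1989LargeFieldI] T. Bałaban, Commun. Math. Phys. 122 (1989) 175–202, Prop. 1 p. 194.
-/

noncomputable section
open scoped Matrix.Norms.L2Operator

namespace Literature.MathematicalPhysics.QuantumFieldTheory.Balaban1983to89.B15Prop1PlaquetteLettersOfClass

open T4Continuum B15DeterminingSets GaugeField B8Eq17ClassAkV1 BlockAveraging
open T4CubeChartGnomonic (SU2)
open T4AxialGaugeSmallField (castSite boxPlaqs boxBonds)
open B15Prop1Carrier (plaqsInside)
open B14.Eq213MaximalDomains (side)
open B14.Eq213DetSet (Bj maxDomT dist_maxDomT)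
open B15Eq112TorusCover (lift cover cover_lift)
open B14DomainGeom (Within)
open B7Prop1Explicit (e e_apply)
open Literature.MathematicalPhysics.QuantumFieldTheory.BalabanImbrieJaffe1984to88.BIJ85Eq453GaugeField (qsstarGIter0)

variable {F : T4Family}

/-! ## §1  The class's plaquette conjunct -/

/-- `η_j² ≤ 1` (`η_j = L^{-j}`, `L ≥ 1`). [cite: Balaban1985Variational, (2) p.278 (bookkeeping)] -/
theorem eta_sq_le_one (K j : ℕ) : (F.P K).eta j ^ 2 ≤ 1 := by
  have hL : (1 : ℝ) ≤ (F.P K).L := by exact_mod_cast (F.P K).L_pos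
  have h0 : 0 ≤ ((F.P K).L : ℝ)⁻¹ := inv_nonneg.mpr (by linarith)
  have h1 : ((F.P K).L : ℝ)⁻¹ ≤ 1 := inv_le_one_of_one_le₀ hL
  have hη : (F.P K).eta j ≤ 1 := pow_le_one₀ h0 h1
  have hη0 : 0 ≤ (F.P K).eta j := pow_nonneg h0 _
  nlinarith

/-- **THE CLASS's FIRST CONJUNCT** ([15] (2) *«|U(∂p) − 1| < ε₀η_j² for p ∈ Ω_j»*), tolerance weakened to `εreg`: a field of print's regularity class `U_k({Ω_j}, εreg)` of record is
`εreg`-plaquette-small on every plaquette with a corner in the level-`j` set of the top sequence (`j ≤ k`; level `0` = the support of record). [cite: Balaban1985Variational, (2) p.278; Balaban1988Convergent, (2.12) p.256] -/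
theorem dist1_plaqHol_lt_of_mem_class (ν : Node00.Stage7Numerics) (K k : ℕ) (Ω : ℕ → Set (Site (F.P K) 0))
    {U : GaugeField (F.P K) 0 SU2} (hU : U ∈ Node00.regMSCoPOfRecord F 2 ν K k Ω) (hε : 0 ≤ ν.εreg) {j : ℕ} (hj : j ≤ k)
    {p : Plaq (F.P K) 0} (hp : p ∈ plaqsOf (Node00.topSeq (Node00.suppDomOfRecord F ν K Ω) Ω j)) :
    dist1 (GaugeField.plaqHol U p) < ν.εreg := by
  have h : dist1 (GaugeField.plaqHol U p) < ν.εreg * (F.P K).eta j ^ 2 := hU.1 j hj p hp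
  have h2 : ν.εreg * (F.P K).eta j ^ 2 ≤ ν.εreg * 1 := mul_le_mul_of_nonneg_left (eta_sq_le_one K j) hε
  linarith

/-! ## §2  The letter `hPχ`: plaquettes with a corner-bond starting in `Ω₁(Z)` -/

/-- ★★ **`hPχ` FROM THE CLASS**: for a (2.12) minimiser `U₀` over the class of record of `Z`'s maximal sequence at height `k ≥ 1`, every plaquette one of whose four boundary bonds
(in the endpoints' spelling) starts in `Ω₁(Z)` satisfies `‖U₀(∂p) − 1‖ ≤ δ` for any `δ ≥ εreg` — such a bond's source is a corner of `p` in `Ω₁(Z)`, the level-`1` set of the class.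
[cite: Balaban1985Variational, (2) p.278; Balaban1988Convergent, (2.12)–(2.13) pp.256–257; Balaban1989LargeFieldI, Prop. 1 p.194] -/
theorem norm_plaqHol_sub_one_le_of_isMinimizer_of_cornerBond (ν : Node00.Stage7Numerics) (Kt : ℕ) {k : ℕ} (hk : 1 ≤ k)
    (Z : Set (Site (F.P Kt) 0)) {𝔹 : DetSet (F.P Kt)} {W : MSField (F.P Kt) SU2} {U₀ : GaugeField (F.P Kt) 0 SU2}
    (hmin : IsMinimizer (Node00.avOfRecord F 2 Kt) (Node00.regMSCoPOfRecord F 2 ν Kt k (maxDomT ν.M₁ Z)) 𝔹 W U₀)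
    (hε : 0 ≤ ν.εreg) {δ : ℝ} (hδ : ν.εreg ≤ δ) (p : Plaq (F.P Kt) 0)
    (hp : (⟨p.src, p.μ⟩ : PBond (F.P Kt) 0) ∈ {b : PBond (F.P Kt) 0 | b.src ∈ maxDomT ν.M₁ Z 1} ∨
      (⟨p.src.shift p.μ, p.ν⟩ : PBond (F.P Kt) 0) ∈ {b : PBond (F.P Kt) 0 | b.src ∈ maxDomT ν.M₁ Z 1} ∨
      (⟨p.src.shift p.ν, p.μ⟩ : PBond (F.P Kt) 0) ∈ {b : PBond (F.P Kt) 0 | b.src ∈ maxDomT ν.M₁ Z 1} ∨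
      (⟨p.src, p.ν⟩ : PBond (F.P Kt) 0) ∈ {b : PBond (F.P Kt) 0 | b.src ∈ maxDomT ν.M₁ Z 1}) :
    ‖((GaugeField.plaqHol U₀ p : SU2) : Matrix (Fin 2) (Fin 2) ℂ) - 1‖ ≤ δ := by
  have hp' : p ∈ plaqsOf (Node00.topSeq (Node00.suppDomOfRecord F ν Kt (maxDomT ν.M₁ Z)) (maxDomT ν.M₁ Z) 1) := by
    rw [Node00.topSeq_of_ne_zero _ _ one_ne_zero, mem_plaqsOf]
    rcases hp with h | h | h | h
    · exact Or.inl h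
    · exact Or.inr (Or.inl h)
    · exact Or.inr (Or.inr (Or.inl h))
    · exact Or.inl h
  have h := dist1_plaqHol_lt_of_mem_class ν Kt k (maxDomT ν.M₁ Z) hmin.1 hε hk hp'
  have e : dist1 (GaugeField.plaqHol U₀ p) = ‖((GaugeField.plaqHol U₀ p : SU2) : Matrix (Fin 2) (Fin 2) ℂ) - 1‖ := rfl
  rw [e] at h
  linarith

/-! ## §3  The letter `hPbox`: the tower boxes around inner `j`-sites -/

/-- ★★ **A BOX PLAQUETTE's SOURCE IS WITHIN THE HALF-WIDTH OF THE CENTRE** (sup-distance on the cover): `p ∈ boxPlaqs (c − r) (c + r)` with source `castSite z` gives `Within r c z`.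
[cite: Balaban1988Convergent, (2.13) p.256 (bookkeeping)] -/
theorem within_of_mem_boxPlaqs {K j : ℕ} {c : Fin (F.P K).d → ℤ} {r : ℤ} {p : Plaq (F.P K) j} {z : Fin (F.P K).d → ℤ}
    (hlo : (fun κ => c κ - r) ≤ z) (hhi : z + e p.μ + e p.ν ≤ fun κ => c κ + r) : Within r c z := by
  intro i
  have h1 := hlo i
  have h2 := hhi i
  simp only [Pi.add_apply, e_apply] at h1 h2
  rw [abs_le]
  constructor
  · split_ifs at h2 <;> linarith
  · linarith

/-- The tower-box half-width fits under the printed separation: `Lʲ + (Lʲ−1)∕2 ≤ LʲM₁ − 1` for `M₁ ≥ 2`. [cite: Balaban1988Convergent, (2.13) p.256 (bookkeeping)] -/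
theorem towerRadius_le_side_sub_one {L M₁ : ℕ} (hL : 1 ≤ L) (hM : 2 ≤ M₁) (j : ℕ) :
    ((L ^ j : ℕ) : ℤ) + (((L ^ j - 1) / 2 : ℕ) : ℤ) ≤ ((side L M₁ j : ℕ) : ℤ) - 1 := by
  have hLj : 1 ≤ L ^ j := Nat.one_le_pow _ _ hL
  have hdiv : (L ^ j - 1) / 2 ≤ L ^ j - 1 := Nat.div_le_self _ _
  have hside : side L M₁ j = L ^ j * M₁ := rfl
  have hmul : 2 * L ^ j ≤ L ^ j * M₁ := by nlinarith
  rw [hside]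
  omega

/-- ★★★ **`hPbox` FROM THE CLASS**: for a (2.12) minimiser `U₀` over the class of record of `Z`'s maximal sequence at height `k ≥ 1` (`M₁ ≥ 2`, `L + (L−1)∕2 ≤ M₁`, `LᵏM₁ ∣ 2L^{m+K}`),
every inner `j`-site `y` (`ι_j y ∈ Ω_j(Z)`, `1 ≤ j ≤ k`) has its fine box of half-width `Lʲ + (Lʲ−1)∕2` around `ι_j y` `δ`-plaquette-small for any `δ ≥ εreg`: a box plaquette's
source lies within `Lʲ + (Lʲ−1)∕2 ≤ LʲM₁ − 1` of `ι_j y`, hence over `Ω_{j−1}(Z)` (*«dist(Ω_j, Ωᶜ_{j−1}) ≥ LʲξM₁»*, `dist_maxDomT`) for `j ≥ 2`, and in the support's `M₁`-layer around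
`Ω₁(Z)` for `j = 1` — a corner in the class's level-`(j−1)` set either way.
[cite: Balaban1985Variational, (2) p.278; Balaban1988Convergent, p.255, (2.12)–(2.13) pp.256–257; Balaban1989LargeFieldI, Prop. 1 p.194] -/
theorem plaqSmallOn_towerBox_of_isMinimizer (ν : Node00.Stage7Numerics) (Kt : ℕ) {k : ℕ}
    (Z : Set (Site (F.P Kt) 0)) {𝔹 : DetSet (F.P Kt)} {W : MSField (F.P Kt) SU2} {U₀ : GaugeField (F.P Kt) 0 SU2}
    (hmin : IsMinimizer (Node00.avOfRecord F 2 Kt) (Node00.regMSCoPOfRecord F 2 ν Kt k (maxDomT ν.M₁ Z)) 𝔹 W U₀)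
    (hM2 : 2 ≤ ν.M₁) (hrad : (F.P Kt).L + ((F.P Kt).L - 1) / 2 ≤ ν.M₁) (hdiv : side (F.P Kt).L ν.M₁ k ∣ (F.P Kt).sitesPerDir 0)
    (hε : 0 ≤ ν.εreg) {δ : ℝ} (hδ : ν.εreg ≤ δ)
    {j : ℕ} (hj1 : 1 ≤ j) (hjk : j ≤ k) (y : Site (F.P Kt) j) (hy : embIter j y ∈ maxDomT ν.M₁ Z j) :
    PlaqSmallOn (boxPlaqs (fun κ => lift (F.P Kt) (embIter j y) κ - ((((F.P Kt).L ^ j : ℕ) : ℤ) + ((((F.P Kt).L ^ j - 1) / 2 : ℕ) : ℤ)))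
      (fun κ => lift (F.P Kt) (embIter j y) κ + ((((F.P Kt).L ^ j : ℕ) : ℤ) + ((((F.P Kt).L ^ j - 1) / 2 : ℕ) : ℤ))) : Set (Plaq (F.P Kt) 0)) δ U₀ := by
  intro p hp
  obtain ⟨z, hlo, hhi, hsrc⟩ := hp
  have hM1 : 1 ≤ ν.M₁ := le_trans (by norm_num) hM2
  have hW : Within ((((F.P Kt).L ^ j : ℕ) : ℤ) + ((((F.P Kt).L ^ j - 1) / 2 : ℕ) : ℤ)) (lift (F.P Kt) (embIter j y)) z :=
    within_of_mem_boxPlaqs hlo hhi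
  -- the source, read on the cover
  have hsrc' : p.src = cover (F.P Kt) z := hsrc
  -- a corner of `p` in the class's level-`(j-1)` set
  have hcorner : p ∈ plaqsOf (Node00.topSeq (Node00.suppDomOfRecord F ν Kt (maxDomT ν.M₁ Z)) (maxDomT ν.M₁ Z) (j - 1)) := by
    rw [mem_plaqsOf]
    refine Or.inl ?_
    rw [hsrc']
    rcases Nat.lt_or_ge j 2 with hj2 | hj2
    · -- `j = 1`: the support's `M₁`-layer around `Ω₁(Z)`
      obtain rfl : j = 1 := by omega
      rw [Nat.sub_self, Node00.topSeq_zero, Node00.suppDomOfRecord_eq]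
      have hr : ((((F.P Kt).L ^ 1 : ℕ) : ℤ) + ((((F.P Kt).L ^ 1 - 1) / 2 : ℕ) : ℤ)) ≤ (ν.M₁ : ℤ) := by
        rw [pow_one]; exact_mod_cast hrad
      have hW' : Within (ν.M₁ : ℤ) z (lift (F.P Kt) (embIter 1 y)) := fun i => by
        rw [abs_sub_comm]; exact (hW i).trans hr
      exact Node00.cover_mem_hullD_one_of_within (by omega) (by rw [cover_lift]; exact hy) hW'
    · -- `j ≥ 2`: over `Ω_{j-1}(Z)` by the printed distance condition
      obtain ⟨n, rfl⟩ : ∃ n, j = n + 1 := ⟨j - 1, by omega⟩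
      rw [Nat.add_sub_cancel, Node00.topSeq_of_ne_zero _ _ (by omega)]
      have hr := towerRadius_le_side_sub_one (F.P Kt).L_pos hM2 (n + 1)
      exact dist_maxDomT hM1 hdiv hjk (by rw [cover_lift]; exact hy) (fun i => (hW i).trans hr)
  have h := dist1_plaqHol_lt_of_mem_class ν Kt k (maxDomT ν.M₁ Z) hmin.1 hε (by omega) hcorner
  exact lt_of_lt_of_le h hδ

/-! ## §4  The family forms: the endpoints' displayed binders, verbatim -/

/-- ★★★ **THE ENDPOINTS' LETTER `hPχ` IS INHABITED BY THE CLASS** — the binder `hPχ` of `N12Prop1DirectOfChartHalfExplicit` ∕ dag-n12-d's (D1)′ ∕ (E1)′ VERBATIM (per instance `i`, per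
guarded base field `Vk`, per (2.12) minimiser `U₀` of the guarded datum), from `0 ≤ εreg ≤ δ i` and `0 < k i`; the guard and the datum rows are idle.
[cite: Balaban1985Variational, (2) p.278; Balaban1988Convergent, (2.12)–(2.13) pp.256–257; Balaban1989LargeFieldI, Prop. 1 p.194] -/
theorem hPχ_on_of_class (ν : Node00.Stage7Numerics) (Kt : ℕ) {ι : Type*} (Z Λ : ι → Set (Site (F.P Kt) 0)) (k : ι → ℕ) (hk0 : ∀ i, 0 < k i)
    (eR : ι → ℝ) (ext : ∀ i, GaugeField (F.P Kt) (k i) SU2 → GaugeField (F.P Kt) (k i) SU2) (LO HI : ι → Fin (F.P Kt).d → ℤ) (ρn : ι → ℝ)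
    (hε : 0 ≤ ν.εreg) (δ : ι → ℝ) (hδ : ∀ i, ν.εreg ≤ δ i) :
    ∀ i (Vk : GaugeField (F.P Kt) (k i) SU2), PlaqSmallOn (plaqsInside (pts (k i) (Z i ∩ (Λ i)ᶜ))) (eR i) Vk →
      (∀ b ∈ (boxBonds (LO i) (HI i) : Set (PBond (F.P Kt) (k i))), dist1 (ext i Vk b) ≤ ρn i) →
      ∀ U₀ : GaugeField (F.P Kt) 0 SU2,
        IsMinimizer (Node00.avOfRecord F 2 Kt) (Node00.regMSCoPOfRecord F 2 ν Kt (k i) (maxDomT ν.M₁ (Z i))) (Bj ν.M₁ (Z i) (k i))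
          (avgFamily (Node00.avOfRecord F 2 Kt) (qsstarGIter0 (k i) (ext i Vk))) U₀ →
        ∀ p : Plaq (F.P Kt) 0, ((⟨p.src, p.μ⟩ : PBond (F.P Kt) 0) ∈ {b : PBond (F.P Kt) 0 | b.src ∈ maxDomT ν.M₁ (Z i) 1} ∨
            (⟨p.src.shift p.μ, p.ν⟩ : PBond (F.P Kt) 0) ∈ {b : PBond (F.P Kt) 0 | b.src ∈ maxDomT ν.M₁ (Z i) 1} ∨
            (⟨p.src.shift p.ν, p.μ⟩ : PBond (F.P Kt) 0) ∈ {b : PBond (F.P Kt) 0 | b.src ∈ maxDomT ν.M₁ (Z i) 1} ∨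
            (⟨p.src, p.ν⟩ : PBond (F.P Kt) 0) ∈ {b : PBond (F.P Kt) 0 | b.src ∈ maxDomT ν.M₁ (Z i) 1}) →
          ‖((GaugeField.plaqHol U₀ p : SU2) : Matrix (Fin 2) (Fin 2) ℂ) - 1‖ ≤ δ i :=
  fun i _ _ _ _ hmin p hp => norm_plaqHol_sub_one_le_of_isMinimizer_of_cornerBond ν Kt (hk0 i) (Z i) hmin hε (hδ i) p hp

/-- ★★★ **THE ENDPOINTS' LETTER `hPbox` IS INHABITED BY THE CLASS** — the binder `hPbox` of dag-n12-d's (D1) ∕ (D1)′ ∕ (E1)′ (the premise of dag-n12-w6's `exists_rightInverse_letter`)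
VERBATIM, from `0 ≤ εreg ≤ δ i`, `2 ≤ M₁`, `L + (L−1)∕2 ≤ M₁` and the cube divisibility at height `k i`; the guard and the datum rows are idle.
[cite: Balaban1985Variational, (2) p.278; Balaban1988Convergent, p.255, (2.12)–(2.13) pp.256–257; Balaban1989LargeFieldI, Prop. 1 p.194] -/
theorem hPbox_on_of_class (ν : Node00.Stage7Numerics) (Kt : ℕ) {ι : Type*} (Z Λ : ι → Set (Site (F.P Kt) 0)) (k : ι → ℕ)
    (eR : ι → ℝ) (ext : ∀ i, GaugeField (F.P Kt) (k i) SU2 → GaugeField (F.P Kt) (k i) SU2) (LO HI : ι → Fin (F.P Kt).d → ℤ) (ρn : ι → ℝ)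
    (hM2 : 2 ≤ ν.M₁) (hrad : (F.P Kt).L + ((F.P Kt).L - 1) / 2 ≤ ν.M₁) (hdiv : ∀ i, side (F.P Kt).L ν.M₁ (k i) ∣ (F.P Kt).sitesPerDir 0)
    (hε : 0 ≤ ν.εreg) (δ : ι → ℝ) (hδ : ∀ i, ν.εreg ≤ δ i) :
    ∀ i (Vk : GaugeField (F.P Kt) (k i) SU2), PlaqSmallOn (plaqsInside (pts (k i) (Z i ∩ (Λ i)ᶜ))) (eR i) Vk →
      (∀ b ∈ (boxBonds (LO i) (HI i) : Set (PBond (F.P Kt) (k i))), dist1 (ext i Vk b) ≤ ρn i) →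
      ∀ U₀ : GaugeField (F.P Kt) 0 SU2,
        IsMinimizer (Node00.avOfRecord F 2 Kt) (Node00.regMSCoPOfRecord F 2 ν Kt (k i) (maxDomT ν.M₁ (Z i))) (Bj ν.M₁ (Z i) (k i))
          (avgFamily (Node00.avOfRecord F 2 Kt) (qsstarGIter0 (k i) (ext i Vk))) U₀ →
        ∀ (j : ℕ), 1 ≤ j → j ≤ k i → ∀ y : Site (F.P Kt) j, embIter j y ∈ maxDomT ν.M₁ (Z i) j →
          PlaqSmallOn (boxPlaqs (fun κ => lift (F.P Kt) (embIter j y) κ - ((((F.P Kt).L ^ j : ℕ) : ℤ) + ((((F.P Kt).L ^ j - 1) / 2 : ℕ) : ℤ)))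
            (fun κ => lift (F.P Kt) (embIter j y) κ + ((((F.P Kt).L ^ j : ℕ) : ℤ) + ((((F.P Kt).L ^ j - 1) / 2 : ℕ) : ℤ))) : Set (Plaq (F.P Kt) 0)) (δ i) U₀ :=
  fun i _ _ _ _ hmin _ hj1 hjk y hy => plaqSmallOn_towerBox_of_isMinimizer ν Kt (Z i) hmin hM2 hrad (hdiv i) hε (hδ i) hj1 hjk y hy

end Literature.MathematicalPhysics.QuantumFieldTheory.Balaban1983to89.B15Prop1PlaquetteLettersOfClass

end
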